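import Mathlib
import Summits.ValiantsHypothesis.ValiantsHypothesis.Theses.NewtonUnitEquations
import Literature.Computability.AlgebraicComplexity.NewtonPolygonTau
import Literature.Computability.AlgebraicComplexity.NewtonPolygonTauProductBounds
import Summits.ValiantsHypothesis.ValiantsHypothesis.Theorems.NewtonUnitEquationsTwoProductsMahlerRadixRecursionDefs

/-!
# Crux `TwoProducts` (stmt-ValiantsHypothesis-5906), line `mahler-radix-recursion`: STUB (α) `stub_outerVertices`

The registered line `Cruxes/TwoProducts/Lines/mahler-radix-recursion.lean` (induction on scales; NOT the item's
skeleton of record) peels one factor pair, `∏ f − ∏ g = f_i · W_i + (f_i − g_i) · S_i`, and splits the vertices of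
`Newt(∏ f − ∏ g)` into those of the FRAME HULL `K_i = conv(supp(f_i W_i) ∪ supp((f_i − g_i) S_i))` and the HIDDEN
ones.  STUB (α) (`stub_outerVertices`, "everything else is Ostrowski", provable now) bounds the former:

  `#vert K_i ≤ vert(W_i) + (m+3)·t`.

This file proves it — statement = the line's `OuterVertices` body VERBATIM over the objects of
`Theorems/NewtonUnitEquationsTwoProductsMahlerRadixRecursionDefs.lean` (= the line's objects, same names and bodies)
— from the tree's planar toolkit BY NAME (`Literature/…/NewtonPolygonTauProductBounds.lean`): Ostrowski + planar
Minkowski `newtonVertexCount_mul_le` (`vert(pq) ≤ vert p + vert q`), `newtonVertexCount_le_card_support`,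
`newtonVertexCount_prod_le_mul` (`vert(∏_{j≠i} g_j) ≤ m·t`), and `#vert conv(X ∪ Y) ≤ #vert conv X + #vert conv Y`
(`ncard_Vx_union_le`, from `inter_extremePoints_subset_extremePoints_of_subset`).  For `m = 0` the coarse product is
`1` and the second summand costs `≤ 2t ≤ 3t`.

Honest framing: a bookkeeping stub of a registered non-record line; the line's open core (β) `stub_hiddenVertices`,
its regime engine (β_r) `stub_radixScaleStep` and the crux `TwoProducts` are untouched and OPEN; nothing here bears
on `VP ≠ VNP`.
-/

set_option linter.dupNamespace false

noncomputable section

open scoped BigOperators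
open MvPolynomial Literature.Computability.AlgebraicComplexity

namespace Summit.ValiantsHypothesis.ValiantsHypothesis.Theorems.NewtonUnitEquations.TwoProducts.MahlerRadixRecursion

/-- `vert` is the Literature abbreviation `newtonVertexCount` (definitionally). [folklore] -/
theorem vert_eq_newtonVertexCount (W : Poly) : vert W = newtonVertexCount W := rfl

/-- The vertex set of a lattice polygon is finite. [folklore] -/
theorem Vx_finite (A : Finset (Fin 2 →₀ ℕ)) : (Vx A).Finite :=
  (Set.Finite.image ι (Finset.finite_toSet A)).subset extremePoints_convexHull_subset

/-- Vertices of the hull of a union of two finite exponent sets are vertices of the hulls of the parts.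
[folklore] -/
theorem Vx_union_subset (A B : Finset (Fin 2 →₀ ℕ)) : Vx (A ∪ B) ⊆ Vx A ∪ Vx B := by
  intro x hx
  have hxU : x ∈ ι '' ((A ∪ B : Finset (Fin 2 →₀ ℕ)) : Set (Fin 2 →₀ ℕ)) := extremePoints_convexHull_subset hx
  rw [Finset.coe_union, Set.image_union] at hxU
  have hsubA : convexHull ℝ (ι '' (A : Set (Fin 2 →₀ ℕ))) ⊆
      convexHull ℝ (ι '' ((A ∪ B : Finset (Fin 2 →₀ ℕ)) : Set (Fin 2 →₀ ℕ))) :=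
    convexHull_mono (Set.image_mono (by rw [Finset.coe_union]; exact Set.subset_union_left))
  have hsubB : convexHull ℝ (ι '' (B : Set (Fin 2 →₀ ℕ))) ⊆
      convexHull ℝ (ι '' ((A ∪ B : Finset (Fin 2 →₀ ℕ)) : Set (Fin 2 →₀ ℕ))) :=
    convexHull_mono (Set.image_mono (by rw [Finset.coe_union]; exact Set.subset_union_right))
  rcases hxU with hA | hB
  · exact Or.inl (inter_extremePoints_subset_extremePoints_of_subset hsubA ⟨subset_convexHull ℝ _ hA, hx⟩)
  · exact Or.inr (inter_extremePoints_subset_extremePoints_of_subset hsubB ⟨subset_convexHull ℝ _ hB, hx⟩)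

/-- `#vert conv(A ∪ B) ≤ #vert conv A + #vert conv B`. [folklore] -/
theorem ncard_Vx_union_le (A B : Finset (Fin 2 →₀ ℕ)) : (Vx (A ∪ B)).ncard ≤ (Vx A).ncard + (Vx B).ncard :=
  (Set.ncard_le_ncard (Vx_union_subset A B) ((Vx_finite A).union (Vx_finite B))).trans (Set.ncard_union_le _ _)

/-- The Newton polygon of a difference of two `t`-sparse polynomials has at most `2t` vertices. [folklore] -/
theorem vert_sub_le {t : ℕ} (p q : Poly) (hp : p.support.card ≤ t) (hq : q.support.card ≤ t) :
    vert (p - q) ≤ 2 * t := by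
  classical
  calc vert (p - q) ≤ (p - q).support.card := newtonVertexCount_le_card_support (p - q)
    _ ≤ (p.support ∪ q.support).card := Finset.card_le_card (support_sub _ _ _)
    _ ≤ p.support.card + q.support.card := Finset.card_union_le _ _
    _ ≤ 2 * t := by omega

/-- **STUB (α) of line `mahler-radix-recursion` (`stub_outerVertices`), statement expanded verbatim** — "everything
else is Ostrowski": the frame hull `K_i = conv(supp(f_i W_i) ∪ supp((f_i − g_i) S_i))` has at most
`vert(W_i) + (m+3)·t` vertices.  Proof: `#vert conv(X ∪ Y) ≤ #vert conv X + #vert conv Y`; Ostrowski + planar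
Minkowski (`newtonVertexCount_mul_le`) give `vert(f_i W_i) ≤ t + vert W_i` and
`vert((f_i − g_i) S_i) ≤ 2t + vert S_i ≤ 2t + m·t` (`newtonVertexCount_prod_le_mul`; for `m = 0`, `S_i = 1`).
[folklore] -/
theorem stub_outerVertices :
    ∀ (m t : ℕ) (f g : Fin (m + 1) → Poly) (i : Fin (m + 1)), (∀ j, (f j).support.card ≤ t) →
      (∀ j, (g j).support.card ≤ t) → (Vx (peelFrame f g i)).ncard ≤ vert (coarseDiff f g i) + (m + 3) * t := by
  classical
  intro m t f g i hf hg
  have hA : vert (f i * coarseDiff f g i) ≤ t + vert (coarseDiff f g i) :=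
    calc vert (f i * coarseDiff f g i) ≤ vert (f i) + vert (coarseDiff f g i) := newtonVertexCount_mul_le _ _
      _ ≤ t + vert (coarseDiff f g i) :=
          Nat.add_le_add_right ((newtonVertexCount_le_card_support (f i)).trans (hf i)) _
  have hB : vert ((f i - g i) * coarseProd g i) ≤ 2 * t + m * t := by
    rcases Nat.eq_zero_or_pos m with hm | hm
    · subst hm
      have h1 : coarseProd g i = 1 := by simp [coarseProd]
      rw [h1, mul_one]
      exact (vert_sub_le (f i) (g i) (hf i) (hg i)).trans (by omega)
    · calc vert ((f i - g i) * coarseProd g i) ≤ vert (f i - g i) + vert (coarseProd g i) :=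
            newtonVertexCount_mul_le _ _
        _ ≤ 2 * t + m * t := Nat.add_le_add (vert_sub_le (f i) (g i) (hf i) (hg i))
            (newtonVertexCount_prod_le_mul (Nat.pos_iff_ne_zero.mp hm) (fun j => g (i.succAbove j))
              fun j => hg _)
  calc (Vx (peelFrame f g i)).ncard
      ≤ (Vx (f i * coarseDiff f g i).support).ncard + (Vx ((f i - g i) * coarseProd g i).support).ncard :=
        ncard_Vx_union_le _ _
    _ = vert (f i * coarseDiff f g i) + vert ((f i - g i) * coarseProd g i) := rfl
    _ ≤ (t + vert (coarseDiff f g i)) + (2 * t + m * t) := Nat.add_le_add hA hB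
    _ = vert (coarseDiff f g i) + (m + 3) * t := by ring


end Summit.ValiantsHypothesis.ValiantsHypothesis.Theorems.NewtonUnitEquations.TwoProducts.MahlerRadixRecursion

end
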